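import Mathlib.Analysis.SpecialFunctions.Exp
import Mathlib.Analysis.SpecialFunctions.Pow.Real
import Mathlib.Analysis.Real.Pi.Bounds
import HarnessLib

/-!
# Negative side of K2Q `QuasiStaticSolenoidalCellTensorQ` (stmt-AnomalousDissipation-19072): the parameter bookkeeping of the
# general-word floor — real arithmetic only (helper, `--supports stmt-AnomalousDissipation-19072`)

Summits-side helper file (everything proved; no definitions, no named facts).  `galerkin_floor_cell` delivers the floor
`x(t) ≥ x(0)(1−a)e^{−(a(1+2a)/Q)t}` under three numeric hypotheses; to turn it into the REALISED-constant floor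
`e^{−8π²(1+(1+δ)(1−4ρ/3)c₀/ν²)(ν/n²)t}` for `n ≥ n₀(δ, ν, W)` one needs elementary real inequalities, isolated here with the
abbreviations `Δ₀ = 8π²qP/n²` (heat part of a window) and `Δ₁ = Δ₀(1−4ρ/3)c₀/ν²` (realised Taylor part):
* `exp_neg_le_quarter` — `e^{−x} ≤ 1/4` for `x ≥ 3` (rest gap over a window, `π²qP ≥ 3`);
  (for `e^{x} ≤ 3`, `x ≤ 1`, use `Real.exp_one_lt_three`);
* `rate_budget` — if `η ≤ (δ/8)Δ₁`, `d ≤ (1+δ/2)Δ₁`, `Δ₀ ≤ 1`, `16(2Δ₀+3Δ₁)² ≤ δΔ₁`, `2(2Δ₀+3Δ₁) ≤ 1`, `δ ≤ 1`, then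
  `a = η + Δ₀(1+η) + d` satisfies `0 ≤ a ≤ 1/2` and `a(1+2a) ≤ Δ₀ + (1+δ)Δ₁` — the realised rate with precision `δ`.
This is NOT a proof of anomalous dissipation, and by itself not of `¬ K2Q`.
-/

set_option linter.dupNamespace false

noncomputable section

namespace Summit.AnomalousDissipation.AnomalousDissipation.Theorems.QuasiStaticSolenoidalCellTensorQ.Negative

/-- `e^{−x} ≤ 1/4` for `x ≥ 3`. -/
theorem exp_neg_le_quarter {x : ℝ} (hx : 3 ≤ x) : Real.exp (-x) ≤ 1 / 4 := by
  have h1 : x + 1 ≤ Real.exp x := Real.add_one_le_exp x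
  have h4 : (4:ℝ) ≤ Real.exp x := by linarith
  rw [Real.exp_neg, inv_le_comm₀ (Real.exp_pos x) (by norm_num)]
  simpa using h4

/-- **Rate budget.** With `a = η + Δ₀(1+η) + d`: if `0 ≤ η ≤ (δ/8)Δ₁`, `0 ≤ d ≤ (1+δ/2)Δ₁`, `0 ≤ Δ₀ ≤ 1`, `0 ≤ Δ₁`,
`16(2Δ₀+3Δ₁)² ≤ δΔ₁`, `2(2Δ₀+3Δ₁) ≤ 1` and `0 < δ ≤ 1`, then `0 ≤ a`, `a ≤ 1/2` and `a(1+2a) ≤ Δ₀ + (1+δ)Δ₁`. -/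
theorem rate_budget {η d Δ₀ Δ₁ δ : ℝ} (hη0 : 0 ≤ η) (hη : η ≤ δ / 8 * Δ₁) (hd0 : 0 ≤ d) (hd : d ≤ (1 + δ / 2) * Δ₁)
    (hΔ₀0 : 0 ≤ Δ₀) (hΔ₀ : Δ₀ ≤ 1) (hΔ₁ : 0 ≤ Δ₁) (hM : 16 * (2 * Δ₀ + 3 * Δ₁) ^ 2 ≤ δ * Δ₁)
    (hM1 : 2 * (2 * Δ₀ + 3 * Δ₁) ≤ 1) (hδ0 : 0 < δ) (hδ1 : δ ≤ 1) :
    0 ≤ η + Δ₀ * (1 + η) + d ∧ η + Δ₀ * (1 + η) + d ≤ 1 / 2 ∧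
      (η + Δ₀ * (1 + η) + d) * (1 + 2 * (η + Δ₀ * (1 + η) + d)) ≤ Δ₀ + (1 + δ) * Δ₁ := by
  set a := η + Δ₀ * (1 + η) + d with ha
  have ha0 : 0 ≤ a := by rw [ha]; positivity
  have hη1 : η ≤ Δ₁ := by nlinarith
  have hηle1 : η ≤ 1 := by nlinarith
  -- `a ≤ M = 2Δ₀ + 3Δ₁`
  have haM : a ≤ 2 * Δ₀ + 3 * Δ₁ := by
    rw [ha]
    have : Δ₀ * (1 + η) ≤ 2 * Δ₀ := by nlinarith
    nlinarith
  have ha2 : a ≤ 1 / 2 := by linarith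
  refine ⟨ha0, ha2, ?_⟩
  -- `2a² ≤ 2M² ≤ (δ/8)Δ₁`
  have hsq : 2 * a ^ 2 ≤ δ / 8 * Δ₁ := by
    have h1 : a ^ 2 ≤ (2 * Δ₀ + 3 * Δ₁) ^ 2 := pow_le_pow_left₀ ha0 haM 2
    nlinarith
  -- `Δ₀ η ≤ (δ/8)Δ₁`
  have hΔη : Δ₀ * η ≤ δ / 8 * Δ₁ := by nlinarith
  have e : a * (1 + 2 * a) = a + 2 * a ^ 2 := by ring
  rw [e, ha]
  nlinarith

end Summit.AnomalousDissipation.AnomalousDissipation.Theorems.QuasiStaticSolenoidalCellTensorQ.Negative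

end
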